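import Mathlib
import Summits.QuantumFields.BalabanUV.Beta.AnalyticWalkSum216RowResolvent

/-!
# [Balaban1988RG2Cluster] (1.6)–(1.7) p. 3 «H = Σ_ω H_ω … the terms are localized» ∕ [Balaban1985BackgroundPropagators]
# (3.107)–(3.108) p. 416 — THE REGROUPING GLUE BETWEEN THE LAYERS OF THE ROW-D4 CHAIN: a walk-term family whose
# (τ-independent) majorant DOMINATES the extremal decoration weight `e^{κ₁·#S(w)}·‖A_w‖` regroups, by dependence set
# `S`, into a FINITE piece family `G_S := Σ_{S(w) = S} A_w` satisfying EXACTLY the (T3)-shape input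
# `Σ_j (Σ_S e^{κ₁#S}‖G_S(i,j)‖)e^{κd(i,j)} ≤ ρ` of `AnalyticWalkSum216RowResolvent.rowData_decPieces` (cell topic
# `Summits/QuantumFields/BalabanUV/Beta`; row-D4 NODE A, the currency match between layer outputs and layer inputs)

HONEST FRAMING (cell rule).  Discharging `BetaPertH` makes Bałaban's UV stability UNCONDITIONAL — a real constructive-QFT
result; NOT the continuum limit, NOT the Clay problem.  This module discharges NOTHING of `BetaPertH`.  [folklore]
bookkeeping answering ONE interface question of the gen-38 chain G̃₀ → G₂ → G̃₂ → G̃₃(x) (`AnalyticWalkSum216RowPerturbation`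
∕ `…RowConstrained` ∕ `…RowResolvent(Omega,Proj)`, census `BETA/REMAINDER-BETA.md` §10.26): each layer OUTPUTS row data of
an infinite decorated walk family, while the next layer's (T3)-slot INPUTS a FINITE piece family `G : Ω → Matrix` with the
localised `e^{κ₁#cells}`-weighted bound (`rowData_decPieces`'s `hG`) — and the co-owner's ω-machinery needs `[Fintype Ω]`
pieces.  The glue is regrouping by DEPENDENCE SET (on a finite cell set `Δ` the index `Finset Δ` is finite): if the
family's majorant dominates the EXTREMAL coefficient (`e^{κ₁#S(w)}·‖A_w(i,j)‖ ≤ m_w(i,j)` — true for every family built in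
this chain, §2), then the pieces `G_S := Σ'_{w : S(w) = S} A_w` satisfy the (T3)-shape bound with the SAME constant `ρ`
and sum to `Σ'_w A_w` (§3).  Re-decorating the regrouped pieces with SET monomials (the next layer's `decPieces`) keeps
the value at `s ≡ 1`, the zero pattern and the majorant shape — the co-owner's XREAD remark C-d4p3-6∕-8 INFO-2 (product
vs set monomials) made precise: the chain's families agree with [II]'s `H(s)` in exactly these three respects, layer by
layer.  Nothing of Bałaban's operators is instantiated; NO class change on any GAPS row; readiness width 0 unchanged;
NOT summit progress.  Unit `b2b-balaban-beta-an4-g38` (owner of `BINDER-OWNERS.md` row D4); `GAPS.md` C-an4-99.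

CITATION HEADER (lean-in-tree rule).  [II] = T. Bałaban, *Renormalization group approach to lattice gauge field theories.
II. Cluster expansions*, Commun. Math. Phys. **116**, 1–22 (1988) [Balaban1988RG2Cluster], p. 3 [PDF 3] (render
`HOME/b2b-balaban-ref1/pages/1988-cmp116-rg-II-cluster/…-p003-x2.png`, read as image by this lineage gens 34–35; quoted in
`DecouplingResummation110`'s header): the walk expansions `H = Σ_ω H_ω` with terms localised in unions of cubes and the
monomials `Π s(□)` of (1.7)–(1.8).  [13] = T. Bałaban, *Propagators for lattice gauge theories in a background field*,
Commun. Math. Phys. **99**, 389–434 (1985) [Balaban1985BackgroundPropagators], Thm 3.10 (3.107)–(3.108) p. 416.  Nothing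
printed is asserted; the displays LOCATE «terms regrouped by localisation domain» (the lineage's
`DecouplingResummation110.sum_term19_eq_sum_connected` is the (1.9) = (1.10) instance of the same regrouping).

WHAT IS CERTIFIED HERE (kernel, sorry-free; [folklore]).
§1 `Dominates κ₁ S A m` := `∀ w i j, e^{κ₁#S(w)}·‖A_w(i,j)‖ ≤ m_w(i,j)` (a predicate with parameters; NOT a cited fact).
§2 Constructors: `dominates_pieces` (the `decPieces`∕`pieceMaj` input: equality), `Dominates.const` (`S = ∅`),
   `Dominates.smul` (‖c‖ ≤ X), `Dominates.sum` (`Sum.elim`), **`Dominates.prod`** (product terms `A_wB_v`, dependence set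
   `S(w) ∪ S′(v)`, majorant `prodMaj` — by `#(S ∪ S′) ≤ #S + #S′`); the siblings' recombination skeleton
   `G ⊔ (−x)·G·(P·Ω·Q)·G` is `sum ∘ smul ∘ prod ∘ prod` of these (with `const` for `P`, `Q`).
§3 **`regroup_bound`**: `Dominates` + entrywise summability of `m` + localised rows `Σ_j (Σ'_w m_w(i,j))e^{κd} ≤ ρ` ⟹ the
   pieces `pieceOf A S S′ := Σ'_{S(w) = S′} A_w` satisfy `∀ i, Σ_j (Σ_{S′} e^{κ₁#S′}‖pieceOf A S S′(i,j)‖)e^{κd(i,j)} ≤ ρ` —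
   LITERALLY the `hG` of `rowData_decPieces` with `DG := id`; **`Ktot_pieceOf`**: `Σ_{S′} pieceOf A S S′ = Σ'_w A_w`
   entrywise; `termSum_eq_Ktot_pieceOf`: a family with `T_w(1) = A_w` has `termSum T 1 = Σ_{S′} pieceOf A S S′`.
§4 Non-vacuity.
NOT CLAIMED.  The domination for the co-owner's `decFamilyΩ` output (it holds by the proof of their `rowData_decFamilyΩ.hm`
with the constant coefficient `e^{κ₁#decΩ}` in place of the monomial — not re-derived here), the Neumann family's (by
induction on the order — not needed by the finite-piece layers as stated); any instance.  NOT summit progress.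
PRIOR ART IN THE TREE (searched 2026-08-20): `DecouplingResummation110(Polydisc)` (an4 gen 34: regrouping of the (1.9) sum
over connected domains — same idea, different objects); `AnalyticWalkSum216RowData` (`majSum`, `RowData`); the siblings.
-/

namespace Summit.QuantumFields.BalabanUV.Beta.AnalyticWalkSum216RowRegroup

open Metric Set
open Literature.MathematicalPhysics.QuantumFieldTheory.Balaban1983to89
open B13PerturbativeStep (WRS WeightHyp wrs)
open Summit.QuantumFields.BalabanUV.Beta.AnalyticWalkSum216 (termSum majSum)
open Summit.QuantumFields.BalabanUV.Beta.AnalyticWalkSum216Algebra (prodMaj)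
open Summit.QuantumFields.BalabanUV.Beta.AnalyticWalkSum216Recomb (RIdx recombMaj)
open Summit.QuantumFields.BalabanUV.Beta.AnalyticWalkSum216RowResolvent (pieceMaj sandMaj)
open Summit.QuantumFields.BalabanUV.Beta.UnitLatticeOmegaTerms (Ktot)

noncomputable section

variable {Y : Type*} [Fintype Y] {W V Δ : Type*} [DecidableEq Δ]

/-! ## §1 Domination of the extremal decoration weight -/

/-- `Dominates κ₁ S A m`: the majorant `m_w` dominates the EXTREMAL decoration weight of the undecorated term `A_w` with
dependence set `S(w)`: `e^{κ₁·#S(w)}·‖A_w(i,j)‖ ≤ m_w(i,j)`. [folklore] -/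
def Dominates (κ₁ : ℝ) (S : W → Finset Δ) (A : W → Matrix Y Y ℂ) (m : W → Y → Y → ℝ) : Prop :=
  ∀ w i j, Real.exp (κ₁ * (S w).card) * ‖A w i j‖ ≤ m w i j

namespace Dominates

variable {κ₁ : ℝ} {S : W → Finset Δ} {A : W → Matrix Y Y ℂ} {m : W → Y → Y → ℝ}

omit [Fintype Y] [DecidableEq Δ] in
/-- The majorant is nonnegative. [folklore] -/
theorem m_nonneg (h : Dominates κ₁ S A m) (w : W) (i j : Y) : 0 ≤ m w i j :=
  (mul_nonneg (Real.exp_pos _).le (norm_nonneg _)).trans (h w i j)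

omit [Fintype Y] [DecidableEq Δ] in
/-- With `κ₁ ≥ 0` the undecorated entries are below the majorant. [folklore] -/
theorem norm_le (h : Dominates κ₁ S A m) (hκ₁ : 0 ≤ κ₁) (w : W) (i j : Y) : ‖A w i j‖ ≤ m w i j :=
  (le_mul_of_one_le_left (norm_nonneg _) (Real.one_le_exp (mul_nonneg hκ₁ (Nat.cast_nonneg _)))).trans (h w i j)

omit [Fintype Y] [DecidableEq Δ] in
/-- **Scalar multiples**: `‖c‖ ≤ X` ⟹ `c•A` is dominated by `X·m` (same dependence sets). [folklore] -/
theorem smul (h : Dominates κ₁ S A m) {c : ℂ} {X : ℝ} (hc : ‖c‖ ≤ X) :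
    Dominates κ₁ S (fun w => c • A w) (fun w i j => X * m w i j) := fun w i j => by
  show Real.exp (κ₁ * (S w).card) * ‖(c • A w) i j‖ ≤ X * m w i j
  rw [Matrix.smul_apply, smul_eq_mul, norm_mul, mul_left_comm]
  exact mul_le_mul hc (h w i j) (mul_nonneg (Real.exp_pos _).le (norm_nonneg _)) ((norm_nonneg c).trans hc)

omit [Fintype Y] [DecidableEq Δ] in
/-- **Sums of families** (`Sum.elim`). [folklore] -/
theorem sum {S' : V → Finset Δ} {B : V → Matrix Y Y ℂ} {m' : V → Y → Y → ℝ} (h : Dominates κ₁ S A m)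
    (h' : Dominates κ₁ S' B m') : Dominates κ₁ (Sum.elim S S') (Sum.elim A B) (Sum.elim m m') := by
  rintro (w | v) i j
  · exact h w i j
  · exact h' v i j

/-- **PRODUCTS**: `A_w·B_v` with dependence set `S(w) ∪ S′(v)` is dominated by `prodMaj m m′` — since
`#(S ∪ S′) ≤ #S + #S′`, `e^{κ₁#(S∪S′)}‖Σ_k A(i,k)B(k,j)‖ ≤ Σ_k (e^{κ₁#S}‖A(i,k)‖)(e^{κ₁#S′}‖B(k,j)‖)`. [folklore] -/
theorem prod {S' : V → Finset Δ} {B : V → Matrix Y Y ℂ} {m' : V → Y → Y → ℝ} (hκ₁ : 0 ≤ κ₁)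
    (h : Dominates κ₁ S A m) (h' : Dominates κ₁ S' B m') :
    Dominates κ₁ (fun p : W × V => S p.1 ∪ S' p.2) (fun p => A p.1 * B p.2) (prodMaj m m') := fun p i j => by
  show Real.exp (κ₁ * ((S p.1 ∪ S' p.2).card : ℕ)) * ‖(A p.1 * B p.2) i j‖ ≤ prodMaj m m' p i j
  rw [AnalyticWalkSum216Algebra.prodMaj_apply, Matrix.mul_apply]
  have hcard : Real.exp (κ₁ * ((S p.1 ∪ S' p.2).card : ℕ)) ≤
      Real.exp (κ₁ * (S p.1).card) * Real.exp (κ₁ * (S' p.2).card) := by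
    rw [← Real.exp_add, ← mul_add]
    refine Real.exp_le_exp.2 (mul_le_mul_of_nonneg_left ?_ hκ₁)
    exact_mod_cast Finset.card_union_le (S p.1) (S' p.2)
  calc Real.exp (κ₁ * ((S p.1 ∪ S' p.2).card : ℕ)) * ‖∑ k, A p.1 i k * B p.2 k j‖
      ≤ Real.exp (κ₁ * (S p.1).card) * Real.exp (κ₁ * (S' p.2).card) * ∑ k, ‖A p.1 i k‖ * ‖B p.2 k j‖ :=
        mul_le_mul hcard ((norm_sum_le _ _).trans (Finset.sum_le_sum fun k _ => norm_mul_le _ _))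
          (norm_nonneg _) (by positivity)
    _ = ∑ k, (Real.exp (κ₁ * (S p.1).card) * ‖A p.1 i k‖) * (Real.exp (κ₁ * (S' p.2).card) * ‖B p.2 k j‖) := by
        rw [Finset.mul_sum]
        exact Finset.sum_congr rfl fun k _ => by ring
    _ ≤ ∑ k, m p.1 i k * m' p.2 k j :=
        Finset.sum_le_sum fun k _ => mul_le_mul (h p.1 i k) (h' p.2 k j)
          (mul_nonneg (Real.exp_pos _).le (norm_nonneg _)) (h.m_nonneg p.1 i k)

end Dominates

omit [Fintype Y] [DecidableEq Δ] in
/-- **A parameter-free factor** (sandwich matrix `P`, empty dependence set) is dominated by its entrywise norms. [folklore] -/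
theorem dominates_const {κ₁ : ℝ} (P : Matrix Y Y ℂ) :
    Dominates κ₁ (fun _ : Unit => (∅ : Finset Δ)) (fun _ => P) (fun _ i j => ‖P i j‖) := fun _ i j => by
  rw [Finset.card_empty, Nat.cast_zero, mul_zero, Real.exp_zero, one_mul]

omit [Fintype Y] [DecidableEq Δ] in
/-- **The (T3)-slot input itself**: the pieces `G` with decoration sets `DG` are dominated by `pieceMaj κ₁ G DG`
(equality). [folklore] -/
theorem dominates_pieces {Ω : Type*} (κ₁ : ℝ) (G : Ω → Matrix Y Y ℂ) (DG : Ω → Finset Δ) :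
    Dominates κ₁ DG G (pieceMaj κ₁ G DG) := fun _ _ _ => le_rfl

/-! ## §3 Regrouping by dependence set -/

section Regroup

variable [Fintype Δ] {κ : ℝ} {d : Y → Y → ℝ} {κ₁ : ℝ} {S : W → Finset Δ} {A : W → Matrix Y Y ℂ}
  {m : W → Y → Y → ℝ} {ρ : ℝ}

/-- THE REGROUPED PIECES: `pieceOf A S S′ := Σ'_{w : S(w) = S′} A_w` (entrywise series). [cite: Balaban1988RG2Cluster, (1.6)–(1.7) p.3] -/
def pieceOf (A : W → Matrix Y Y ℂ) (S : W → Finset Δ) (S' : Finset Δ) : Matrix Y Y ℂ :=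
  fun i j => ∑' w, if S w = S' then A w i j else 0

omit [Fintype Y] [Fintype Δ] in
/-- Summability of the indicator-restricted entries. [folklore] -/
theorem summable_ite (hdom : Dominates κ₁ S A m) (hκ₁ : 0 ≤ κ₁) (hsum : ∀ i j, Summable fun w => m w i j)
    (S' : Finset Δ) (i j : Y) : Summable fun w => if S w = S' then A w i j else 0 := by
  refine Summable.of_norm_bounded (hsum i j) fun w => ?_
  split_ifs
  · exact hdom.norm_le hκ₁ w i j
  · rw [norm_zero]; exact hdom.m_nonneg w i j

omit [Fintype Y] [Fintype Δ] [DecidableEq Δ] in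
/-- Summability of the weighted norms. [folklore] -/
theorem summable_weighted (hdom : Dominates κ₁ S A m) (hsum : ∀ i j, Summable fun w => m w i j) (i j : Y) :
    Summable fun w => Real.exp (κ₁ * (S w).card) * ‖A w i j‖ :=
  .of_nonneg_of_le (fun _ => mul_nonneg (Real.exp_pos _).le (norm_nonneg _)) (fun w => hdom w i j) (hsum i j)

omit [Fintype Y] in
/-- **The weighted piece norms are below the summed majorant**: `Σ_{S′} e^{κ₁#S′}‖pieceOf A S S′(i,j)‖ ≤ Σ'_w m_w(i,j)`.
[folklore] -/
theorem sum_pieceMaj_le (hdom : Dominates κ₁ S A m) (hκ₁ : 0 ≤ κ₁) (hsum : ∀ i j, Summable fun w => m w i j)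
    (i j : Y) : ∑ S' : Finset Δ, pieceMaj κ₁ (pieceOf A S) (fun S' => S') S' i j ≤ majSum m i j := by
  have hw := summable_weighted hdom hsum i j
  -- each weighted piece norm ≤ the restricted weighted series
  have h1 : ∀ S' : Finset Δ, pieceMaj κ₁ (pieceOf A S) (fun S' => S') S' i j ≤
      ∑' w, if S w = S' then Real.exp (κ₁ * (S w).card) * ‖A w i j‖ else 0 := by
    intro S'
    have hs : Summable fun w => if S w = S' then Real.exp (κ₁ * (S w).card) * ‖A w i j‖ else 0 := by
      refine .of_nonneg_of_le (fun w => ?_) (fun w => ?_) hw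
      · split_ifs
        · exact mul_nonneg (Real.exp_pos _).le (norm_nonneg _)
        · exact le_rfl
      · split_ifs
        · exact le_rfl
        · exact mul_nonneg (Real.exp_pos _).le (norm_nonneg _)
    rw [pieceMaj, pieceOf]
    calc Real.exp (κ₁ * S'.card) * ‖∑' w, if S w = S' then A w i j else 0‖
        ≤ Real.exp (κ₁ * S'.card) * ∑' w, ‖if S w = S' then A w i j else 0‖ :=
          mul_le_mul_of_nonneg_left (norm_tsum_le_tsum_norm (summable_ite hdom hκ₁ hsum S' i j).norm)
            (Real.exp_pos _).le
      _ = ∑' w, Real.exp (κ₁ * S'.card) * ‖if S w = S' then A w i j else 0‖ := by rw [tsum_mul_left]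
      _ = ∑' w, if S w = S' then Real.exp (κ₁ * (S w).card) * ‖A w i j‖ else 0 := by
          refine tsum_congr fun w => ?_
          split_ifs with h
          · rw [h]
          · rw [norm_zero, mul_zero]
  -- sum over S′ and interchange: exactly one S′ matches each w
  calc ∑ S' : Finset Δ, pieceMaj κ₁ (pieceOf A S) (fun S' => S') S' i j
      ≤ ∑ S' : Finset Δ, ∑' w, if S w = S' then Real.exp (κ₁ * (S w).card) * ‖A w i j‖ else 0 :=
        Finset.sum_le_sum fun S' _ => h1 S'
    _ = ∑' w, ∑ S' : Finset Δ, if S w = S' then Real.exp (κ₁ * (S w).card) * ‖A w i j‖ else 0 := by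
        rw [Summable.tsum_finsetSum]
        intro S' _
        refine .of_nonneg_of_le (fun w => ?_) (fun w => ?_) hw
        · split_ifs
          · exact mul_nonneg (Real.exp_pos _).le (norm_nonneg _)
          · exact le_rfl
        · split_ifs
          · exact le_rfl
          · exact mul_nonneg (Real.exp_pos _).le (norm_nonneg _)
    _ = ∑' w, Real.exp (κ₁ * (S w).card) * ‖A w i j‖ :=
        tsum_congr fun w => by simp only [Finset.sum_ite_eq, Finset.mem_univ, if_true]
    _ ≤ majSum m i j := Summable.tsum_le_tsum (fun w => hdom w i j) hw (hsum i j)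

/-- **REGROUPING**: the regrouped finite piece family satisfies EXACTLY the (T3)-shape input of
`AnalyticWalkSum216RowResolvent.rowData_decPieces` (with `DG := id`) with the SAME constant `ρ`:
`∀ i, Σ_j (Σ_{S′} e^{κ₁#S′}‖pieceOf A S S′(i,j)‖)·e^{κd(i,j)} ≤ ρ`. [cite: Balaban1985BackgroundPropagators, Thm 3.10 (3.108) p.416] -/
theorem regroup_bound (hdom : Dominates κ₁ S A m) (hκ₁ : 0 ≤ κ₁) (hsum : ∀ i j, Summable fun w => m w i j)
    (hρ : ∀ i, ∑ j, majSum m i j * Real.exp (κ * d i j) ≤ ρ) (i : Y) :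
    ∑ j, (∑ S' : Finset Δ, pieceMaj κ₁ (pieceOf A S) (fun S' => S') S' i j) * Real.exp (κ * d i j) ≤ ρ :=
  (Finset.sum_le_sum fun j _ => mul_le_mul_of_nonneg_right (sum_pieceMaj_le hdom hκ₁ hsum i j)
    (Real.exp_pos _).le).trans (hρ i)

omit [Fintype Y] in
/-- **The regrouped pieces sum to the whole series**: `Σ_{S′} pieceOf A S S′ = Σ'_w A_w` entrywise. [folklore] -/
theorem Ktot_pieceOf (hdom : Dominates κ₁ S A m) (hκ₁ : 0 ≤ κ₁) (hsum : ∀ i j, Summable fun w => m w i j)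
    (i j : Y) : Ktot (pieceOf A S) i j = ∑' w, A w i j := by
  rw [Ktot, Matrix.sum_apply]
  simp only [pieceOf]
  rw [← Summable.tsum_finsetSum (fun S' _ => summable_ite hdom hκ₁ hsum S' i j)]
  exact tsum_congr fun w => by simp only [Finset.sum_ite_eq, Finset.mem_univ, if_true]

omit [Fintype Y] in
/-- … hence a decorated family `T` with `T_w(1) = A_w` (all monomials `= 1` at `s ≡ 1`) has
`termSum T 1 = Σ_{S′} pieceOf A S S′` — the value the next layer's `termSum_decPieces_one` reproduces after re-decoration
with set monomials. [folklore] -/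
theorem termSum_eq_Ktot_pieceOf (hdom : Dominates κ₁ S A m) (hκ₁ : 0 ≤ κ₁) (hsum : ∀ i j, Summable fun w => m w i j)
    {T : W → ℂ → Matrix Y Y ℂ} (hT1 : ∀ w, T w 1 = A w) : termSum T 1 = Ktot (pieceOf A S) := by
  ext i j
  rw [Ktot_pieceOf hdom hκ₁ hsum i j, termSum]
  exact tsum_congr fun w => by rw [hT1 w]

end Regroup

/-! ## §4 Non-vacuity -/

/-- The hypotheses of `regroup_bound` are jointly satisfiable: one site, one cell, two terms `A₀ = A₁ = 1` with
dependence sets `∅` and `{()}`, `κ₁ = 0`, majorant `1`, trivial distance, `ρ = 2`. [folklore] -/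
example (i : Unit) : ∑ j : Unit, (∑ S' : Finset Unit,
      pieceMaj (0 : ℝ) (pieceOf (fun _ : Fin 2 => (1 : Matrix Unit Unit ℂ))
        (fun w : Fin 2 => if w = 0 then (∅ : Finset Unit) else {()})) (fun S' => S') S' i j) *
      Real.exp ((0 : ℝ) * (0 : ℝ)) ≤ 2 := by
  have hdom : Dominates (0 : ℝ) (fun w : Fin 2 => if w = 0 then (∅ : Finset Unit) else {()})
      (fun _ : Fin 2 => (1 : Matrix Unit Unit ℂ)) (fun _ _ _ => (1 : ℝ)) := fun w i j => by
    simp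
  have h := regroup_bound (κ := 0) (d := fun (_ _ : Unit) => (0 : ℝ)) (ρ := 2) hdom le_rfl (fun _ _ => .of_finite)
    (fun i => by simp [majSum, tsum_fintype]) i
  simpa using h

end

end Summit.QuantumFields.BalabanUV.Beta.AnalyticWalkSum216RowRegroup
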